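import Summits.BirchSwinnertonDyer.BirchSwinnertonDyer.Theorems.ErratumRoadFiveRegCertKernelFiveChecker
import HarnessLib

/-!
# Route `ErratumRoadFive` (rung K2, `p ≥ 5`), crux `RamNoErratumDataAtFive` (item stmt-BirchSwinnertonDyer-19624, REST‴):
# the SECOND-ORDER REG5CERT kernel checker at certificate depth one (`‖z(Q)‖₅ = 5⁻¹`, precision `5⁻³`): decides the
# Stein–Wuthrich §4.2 height when `v₅(h(Q)) = 2`
# (cell `bsd-stepL`, OWNER seat `bsd-stepL-rest-p2` g7; `--supports stmt-BirchSwinnertonDyer-19624`)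

HONEST FRAMING: BSD is not proved by any of this; nothing here closes the crux; Schneider's non-degeneracy conjecture (barrier
`Literature.Barriers.BirchSwinnertonDyer.PAdicHeightNondegeneracy`) is asserted NOWHERE; every application is ONE curve. The
first-order depth-one checker (`KernelCertFive.certNonsplit_of_certDepthOne`, same seat) decides `h(Q) ≠ 0` exactly when
`v₅(h(Q)) = 1`; at the branch-(D) witness D5 = 635b1 ⊗ (−3208) of crux 19624 the regulator has an extra factor `5`
(PARI `ellpadicregulator` valuation 2, kit j287537; first-order residue `λ⁸ − e'⁸ ≡ 0 (mod 25)`), so one more `5`-adic digit of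
every ingredient is needed. At depth one and relative precision `5⁻³`: `log_Ŵ(z) ≡ z + a₁z²/2 + (a₁²+a₂)z³/3`, `ch(w) ≡ 1 + w/2 + w²/24`,
`σ_q²(ch w) ≡ w + w²/12` (the Tate product `Π` is still invisible: `‖Π − 1‖ ≤ 5⁻³`), and the uniformisation scale enters through its
FIRST digit only, `C² ≡ Γ ≡ −c₄/c₆ (mod 5)` (`c₄(E_q) ≡ 1`, `c₆(E_q) ≡ −1 (mod q)`), in the second-order term `L⁴/(12C²)`:
`C²σ² ≡ 25β`, `12Γβ ≡ 12Γλ² + 25λ⁴ (mod 5³)`, and `h(Q) = log₅(25e'²) − log₅(C²σ²) = 0` would force `5³ ∣ β⁴ − e'⁸`. The `p = 3`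
analogue is reg3-eng's `…RegCertKernelO2*`. Theorems only (0 defs, 0 facts, no `native_decide`); route-free.

* §1 `norm_coshOfSq_sub_quadratic_le_depthOne` (`≤ 5⁻⁵`), `norm_tateSigmaSq_sub_quadratic_le_depthOne` (`≤ 5⁻⁵`);
* §2 `norm_padicFormalLog_sub_cubic_le_depthOne` (`≤ 5⁻⁴` on `‖z‖₅ ≤ 5⁻¹`);
* §3 `norm_uniformisationScaleSq_sub_le_of_congr` (`‖C² − Γ‖₅ ≤ 5⁻¹` from `5 ∣ c₄ + Γc₆`);
* §4 `heightFourOneCoord_ne_zero_of_certDepthOneO2`, `certNonsplit_of_certDepthOneO2`.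

References: [SteinWuthrich2013] §4.2; [MazurSteinTate2006] §1; [SilvermanAEC2009] IV.1, IV.5.5, IV.6.3–6.4, VII.3.4;
[SilvermanATAEC1994] V.3.1; [Iwasawa1972PadicL] §4.4.
-/

open scoped Classical

open Filter Topology PowerSeries IsUltrametricDist WeierstrassCurve Literature.NumberTheory.EllipticCurves
  Literature.NumberTheory.EllipticCurves.Rank1Residual
  Literature.NumberTheory.EllipticCurves.SteinWuthrich2013
  Summit.BirchSwinnertonDyer.Rank1Residual
  Summit.BirchSwinnertonDyer.Rank1Residual.X11b
  Summit.BirchSwinnertonDyer.Rank1Residual.X11b.RegMult.Rung62310y1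

namespace Summit.BirchSwinnertonDyer.Rank1Residual.X11b.RegMult.KernelCertFive

/-! ### §0 Plumbing in `ℚ₅` -/

/-- `‖5^k‖₅ = 1/5^k`. [folklore] -/
private theorem norm_five_pow₂ (k : ℕ) : ‖(5 : ℚ_[5]) ^ k‖ = 1 / (5 : ℝ) ^ k := by
  rw [norm_pow, show (5 : ℚ_[5]) = ((5 : ℕ) : ℚ_[5]) by norm_cast, Padic.norm_p]; simp

/-- `‖5‖₅ = 5⁻¹`. [folklore] -/
private theorem norm_five₂ : ‖(5 : ℚ_[5])‖ = 1 / 5 := by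
  rw [show (5 : ℚ_[5]) = (5 : ℚ_[5]) ^ 1 by norm_num, norm_five_pow₂]; norm_num

/-- `‖25‖₅ = 5⁻²`. [folklore] -/
private theorem norm_twentyfive₂ : ‖(25 : ℚ_[5])‖ = 1 / 25 := by
  rw [show (25 : ℚ_[5]) = (5 : ℚ_[5]) ^ 2 by norm_num, norm_five_pow₂]; norm_num

/-- `‖625‖₅ = 5⁻⁴`. [folklore] -/
private theorem norm_sixtwentyfive₂ : ‖(625 : ℚ_[5])‖ = 1 / 625 := by
  rw [show (625 : ℚ_[5]) = (5 : ℚ_[5]) ^ 4 by norm_num, norm_five_pow₂]; norm_num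

/-- In `ℚ₅`, `‖x‖ < 1 ⇒ ‖x‖ ≤ 5⁻¹`. [folklore] -/
private theorem norm_le_fifth_of_norm_lt_one₂ {x : ℚ_[5]} (hx : ‖x‖ < 1) : ‖x‖ ≤ 1 / 5 := by
  have h := norm_le_inv_of_norm_lt_one (p := 5) hx
  rw [one_div]; exact_mod_cast h

/-- Legendre at `p = 5`: `‖1/(2n)!‖₅ ≤ 5ⁿ`. [cite: SilvermanAEC2009, IV.6.3] -/
private theorem norm_inv_factorial_le₂ (n : ℕ) : ‖(((2 * n).factorial : ℕ) : ℚ_[5])⁻¹‖ ≤ (5 : ℝ) ^ n := by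
  have hf : ((2 * n).factorial : ℕ) ≠ 0 := Nat.factorial_ne_zero _
  rw [norm_inv, Padic.norm_eq_zpow_neg_valuation (by exact_mod_cast hf), Padic.valuation_natCast, zpow_neg,
    inv_inv, zpow_natCast]
  have hv : padicValNat 5 (2 * n).factorial ≤ n := by
    have h := sub_one_mul_padicValNat_factorial (p := 5) (2 * n)
    have hs : (5 - 1) * padicValNat 5 (2 * n).factorial ≤ 2 * n := by rw [h]; exact Nat.sub_le _ _
    omega
  exact_mod_cast Nat.pow_le_pow_right (by norm_num) hv

/-- The general term of `coshOfSq w` has norm `≤ 5^{−n}` for `‖w‖₅ ≤ 5⁻²`. [folklore] -/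
private theorem norm_coshOfSq_term_le₂ {w : ℚ_[5]} (hw : ‖w‖ ≤ 1 / 25) (n : ℕ) :
    ‖w ^ n / (((2 * n).factorial : ℕ) : ℚ_[5])‖ ≤ (1 / 5 : ℝ) ^ n := by
  rw [div_eq_mul_inv, norm_mul, norm_pow]
  calc ‖w‖ ^ n * ‖(((2 * n).factorial : ℕ) : ℚ_[5])⁻¹‖ ≤ (1 / 25 : ℝ) ^ n * (5 : ℝ) ^ n := by
        gcongr; exact norm_inv_factorial_le₂ n
    _ = (1 / 5 : ℝ) ^ n := by rw [← mul_pow]; norm_num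

/-- `‖1/m‖₅ = 5` for `m ∈ {720, 40320}`-type naturals with `v₅(m) = 1`: here `m = 720`. [folklore] -/
private theorem norm_inv_natCast_eq_five {m : ℕ} (hm : m ≠ 0) (h1 : 5 ∣ m) (h2 : ¬ 25 ∣ m) :
    ‖((m : ℚ_[5]))⁻¹‖ = 5 := by
  rw [norm_inv, Padic.norm_eq_zpow_neg_valuation (by exact_mod_cast hm), Padic.valuation_natCast]
  have : padicValNat 5 m = 1 := by
    have hle1 : 1 ≤ padicValNat 5 m := (padicValNat_dvd_iff_le hm).mp (by simpa using h1)
    have hlt2 : ¬ 2 ≤ padicValNat 5 m := fun h => h2 (by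
      have := (padicValNat_dvd_iff_le (p := 5) (n := 2) hm).mpr h; simpa using this)
    omega
  rw [this]; norm_num

/-! ### §1 `ch` and the Tate sigma product to SECOND order at `‖w‖₅ ≤ 5⁻²` -/

/-- **`‖ch(w) − (1 + w/2 + w²/24)‖₅ ≤ 5⁻⁵` for `‖w‖₅ ≤ 5⁻²`**: `‖w³/720‖ = 5‖w‖³ ≤ 5⁻⁵`, `‖w⁴/40320‖ = 5‖w‖⁴ ≤ 5⁻⁷`, every later
term `≤ 5⁻ⁿ ≤ 5⁻⁵`. [folklore] -/
theorem norm_coshOfSq_sub_quadratic_le_depthOne {w : ℚ_[5]} (hw : ‖w‖ ≤ 1 / 25) :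
    ‖coshOfSq w - (1 + w / 2 + w ^ 2 / 24)‖ ≤ 1 / 5 ^ 5 := by
  have hs := summable_coshOfSq_term_depthOne hw
  have hsplit := hs.sum_add_tsum_nat_add 5
  have hdef : coshOfSq w = ∑' n : ℕ, w ^ n / (((2 * n).factorial : ℕ) : ℚ_[5]) := by rw [coshOfSq]
  rw [hdef, ← hsplit]
  simp only [Finset.sum_range_succ, Finset.sum_range_zero, zero_add, pow_zero, Nat.mul_zero, Nat.factorial_zero,
    Nat.cast_one, div_one, pow_one]
  have h2 : (((2 * 1).factorial : ℕ) : ℚ_[5]) = 2 := by norm_num [Nat.factorial]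
  have h24 : (((2 * 2).factorial : ℕ) : ℚ_[5]) = 24 := by norm_num [Nat.factorial]
  have h720 : (((2 * 3).factorial : ℕ) : ℚ_[5]) = ((720 : ℕ) : ℚ_[5]) := by norm_num [Nat.factorial]
  have h40320 : (((2 * 4).factorial : ℕ) : ℚ_[5]) = ((40320 : ℕ) : ℚ_[5]) := by norm_num [Nat.factorial]
  rw [h2, h24, h720, h40320]
  have hring : 1 + w / 2 + w ^ 2 / 24 + w ^ 3 / ((720 : ℕ) : ℚ_[5]) + w ^ 4 / ((40320 : ℕ) : ℚ_[5]) +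
      ∑' n : ℕ, w ^ (n + 5) / (((2 * (n + 5)).factorial : ℕ) : ℚ_[5]) - (1 + w / 2 + w ^ 2 / 24) =
      w ^ 3 / ((720 : ℕ) : ℚ_[5]) + (w ^ 4 / ((40320 : ℕ) : ℚ_[5]) +
        ∑' n : ℕ, w ^ (n + 5) / (((2 * (n + 5)).factorial : ℕ) : ℚ_[5])) := by ring
  rw [hring]
  refine (IsUltrametricDist.norm_add_le_max _ _).trans (max_le ?_ ?_)
  · rw [div_eq_mul_inv, norm_mul, norm_pow, norm_inv_natCast_eq_five (by norm_num) (by norm_num) (by norm_num)]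
    calc ‖w‖ ^ 3 * 5 ≤ (1 / 25 : ℝ) ^ 3 * 5 := by gcongr
      _ = 1 / 5 ^ 5 := by norm_num
  refine (IsUltrametricDist.norm_add_le_max _ _).trans (max_le ?_ ?_)
  · rw [div_eq_mul_inv, norm_mul, norm_pow, norm_inv_natCast_eq_five (by norm_num) (by norm_num) (by norm_num)]
    calc ‖w‖ ^ 4 * 5 ≤ (1 / 25 : ℝ) ^ 4 * 5 := by gcongr
      _ ≤ 1 / 5 ^ 5 := by norm_num
  · refine IsUltrametricDist.norm_tsum_le_of_forall_le_of_nonneg (by norm_num) fun n ↦ ?_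
    refine (norm_coshOfSq_term_le₂ hw (n + 5)).trans ?_
    calc (1 / 5 : ℝ) ^ (n + 5) = (1 / 5) ^ n * (1 / 5) ^ 5 := by rw [pow_add]
      _ ≤ 1 * (1 / 5) ^ 5 := by gcongr; exact pow_le_one₀ (by norm_num) (by norm_num)
      _ = 1 / 5 ^ 5 := by norm_num

/-- **`σ_q²(ch(w)) = w + w²/12 + O(5⁻⁵)` at depth one**: for `‖q‖₅ < 1` and `‖w‖₅ ≤ 5⁻²`,
`‖tateSigmaSq q (coshOfSq w) − (w + w²/12)‖₅ ≤ 5⁻⁵` (`σ² = 2(c − 1)·Π`, `‖2(c − 1) − (w + w²/12)‖ ≤ 5⁻⁵`,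
`‖Π − 1‖ ≤ 5⁻¹·5⁻²`, `‖w + w²/12‖ ≤ 5⁻²`): the Tate product is still invisible. [cite: SteinWuthrich2013, §4.2] -/
theorem norm_tateSigmaSq_sub_quadratic_le_depthOne {q w : ℚ_[5]} (hq : ‖q‖ < 1) (hw : ‖w‖ ≤ 1 / 25) :
    ‖tateSigmaSq q (coshOfSq w) - (w + w ^ 2 / 12)‖ ≤ 1 / 5 ^ 5 := by
  set c := coshOfSq w with hc
  obtain ⟨hc1, hcle⟩ := norm_coshOfSq_sub_one_le_depthOne hw
  have hch := norm_coshOfSq_sub_quadratic_le_depthOne hw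
  have hq5 : ‖q‖ ≤ 1 / 5 := norm_le_fifth_of_norm_lt_one₂ hq
  set P := ∏' n : ℕ, (1 - 2 * q ^ (n + 1) * c + q ^ (2 * (n + 1))) ^ 2 / (1 - q ^ (n + 1)) ^ 4 with hP
  have hP1 : ‖P - 1‖ ≤ 1 / 5 ^ 3 := by
    refine (norm_tprod_tateSigmaSq_factor_sub_one_le hq hcle).trans ?_
    calc ‖q‖ * ‖c - 1‖ ≤ 1 / 5 * (1 / 25) := by gcongr
      _ = 1 / 5 ^ 3 := by norm_num
  have hPle : ‖P‖ ≤ 1 := by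
    have : P = (P - 1) + 1 := by ring
    rw [this]
    exact (IsUltrametricDist.norm_add_le_max _ _).trans (max_le (hP1.trans (by norm_num)) (by rw [norm_one]))
  have h12 : ‖((12 : ℚ_[5]))⁻¹‖ = 1 := by
    rw [norm_inv, show (12 : ℚ_[5]) = ((12 : ℤ) : ℚ_[5]) by norm_cast, norm_intCast_eq_one_of_not_dvd (by decide),
      inv_one]
  have hwq : ‖w + w ^ 2 / 12‖ ≤ 1 / 25 := by
    refine (IsUltrametricDist.norm_add_le_max _ _).trans (max_le hw ?_)
    rw [div_eq_mul_inv, norm_mul, norm_pow, h12, mul_one]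
    calc ‖w‖ ^ 2 ≤ (1 / 25 : ℝ) ^ 2 := by gcongr
      _ ≤ 1 / 25 := by norm_num
  have hdef : tateSigmaSq q c = 2 * (c - 1) * P := by rw [tateSigmaSq]
  have hsplit : tateSigmaSq q c - (w + w ^ 2 / 12) =
      (2 * (c - (1 + w / 2 + w ^ 2 / 24))) * P + (w + w ^ 2 / 12) * (P - 1) := by rw [hdef]; ring
  rw [hsplit]
  refine (IsUltrametricDist.norm_add_le_max _ _).trans (max_le ?_ ?_)
  · rw [norm_mul, norm_mul]
    have h2 : ‖(2 : ℚ_[5])‖ ≤ 1 := by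
      rw [show (2 : ℚ_[5]) = ((2 : ℤ) : ℚ_[5]) by norm_cast]; exact Padic.norm_int_le_one _
    calc ‖(2 : ℚ_[5])‖ * ‖c - (1 + w / 2 + w ^ 2 / 24)‖ * ‖P‖ ≤ 1 * (1 / 5 ^ 5) * 1 := by gcongr
      _ = 1 / 5 ^ 5 := by norm_num
  · rw [norm_mul]
    calc ‖w + w ^ 2 / 12‖ * ‖P - 1‖ ≤ 1 / 25 * (1 / 5 ^ 3) := by gcongr
      _ = 1 / 5 ^ 5 := by norm_num

/-! ### §2 Depth one, third order: `log_Ŵ(z) = z + (a₁/2)z² + ((a₁²+a₂)/3)z³ + O(5⁻⁴)` for `‖z‖₅ ≤ 5⁻¹` -/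

section Padic

variable (V : WeierstrassCurve ℚ_[5]) [V.IsIntegral ℤ_[5]]

omit [V.IsIntegral ℤ_[5]] in
/-- `5⁴·m ≤ 5ᵐ` for `m ≥ 5`. [folklore] -/
private theorem pow_four_mul_le_pow {m : ℕ} (hm : 5 ≤ m) : 5 ^ 4 * m ≤ 5 ^ m := by
  induction m with
  | zero => omega
  | succ k ih =>
    rcases Nat.lt_or_ge k 5 with hk | hk
    · obtain rfl : k = 4 := by omega
      norm_num
    · have h6 : 5 ^ 4 ≤ 5 ^ k := Nat.pow_le_pow_right (by norm_num) (by omega)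
      calc 5 ^ 4 * (k + 1) = 5 ^ 4 * k + 5 ^ 4 := by ring
        _ ≤ 5 ^ k + 5 ^ k := Nat.add_le_add (ih hk) h6
        _ ≤ 5 ^ (k + 1) := by rw [pow_succ]; omega

/-- The terms of degree `≥ 4` of `log_Ŵ(z)` have norm `≤ 5⁻⁴` for `‖z‖₅ ≤ 5⁻¹` (`n = 4` is a unit coefficient; `‖1/n‖₅ ≤ n ≤ 5ⁿ/5⁴`
for `n ≥ 5`). [cite: SilvermanAEC2009, IV.6.3] -/
private theorem norm_formalLog_term_le_depthOne₄ {z : ℚ_[5]} (hz : ‖z‖ ≤ 1 / 5) (n : ℕ) :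
    ‖coeff (n + 4) V.formalLog * z ^ (n + 4)‖ ≤ 1 / 5 ^ 4 := by
  rw [norm_mul, norm_pow]
  have hc := (norm_coeff_formalLog_le_norm_inv V) (n + 2)
  rw [show n + 2 + 2 = n + 4 by ring] at hc
  have hzn : ‖z‖ ^ (n + 4) ≤ (1 / 5 : ℝ) ^ (n + 4) := by gcongr
  rcases Nat.eq_zero_or_pos n with rfl | hn
  · have hunit : ‖(((0 + 4 : ℕ) : ℚ_[5]))⁻¹‖ = 1 := by
      rw [norm_inv, Padic.norm_eq_zpow_neg_valuation (by norm_num), Padic.valuation_natCast,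
        padicValNat.eq_zero_of_not_dvd (by norm_num)]
      simp
    calc ‖coeff (0 + 4) V.formalLog‖ * ‖z‖ ^ (0 + 4) ≤ 1 * (1 / 5 : ℝ) ^ (0 + 4) := by
          gcongr; exact hc.trans hunit.le
      _ = 1 / 5 ^ 4 := by norm_num
  · have hm : ‖(((n + 4 : ℕ) : ℚ_[5]))⁻¹‖ ≤ ((n + 4 : ℕ) : ℝ) := padic_norm_inv_natCast_le (n + 4)
    have hpow := pow_four_mul_le_pow (show 5 ≤ n + 4 by omega)
    have hpow' : ((5 : ℝ) ^ 4) * ((n + 4 : ℕ) : ℝ) ≤ (5 : ℝ) ^ (n + 4) := by exact_mod_cast hpow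
    calc ‖coeff (n + 4) V.formalLog‖ * ‖z‖ ^ (n + 4) ≤ ((n + 4 : ℕ) : ℝ) * (1 / 5 : ℝ) ^ (n + 4) := by
          gcongr; exact hc.trans hm
      _ = ((n + 4 : ℕ) : ℝ) / (5 : ℝ) ^ (n + 4) := by rw [one_div, inv_pow]; ring
      _ ≤ 1 / 5 ^ 4 := by
          rw [div_le_div_iff₀ (by positivity) (by norm_num)]
          linarith

/-- **`log_Ŵ(z) = z + (a₁/2)z² + ((a₁² + a₂)/3)z³ + O(5⁻⁴)` on `‖z‖₅ ≤ 5⁻¹`** for a `5`-integral equation over `ℚ₅`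
(`coeff_two_formalLog`, `coeff_three_formalLog` of the `p = 3` evaluator, generic over `ℚ`-algebras).
[cite: SilvermanAEC2009, IV.1, IV.5.5, IV.6.4] -/
theorem norm_padicFormalLog_sub_cubic_le_depthOne {z : ℚ_[5]} (hz : ‖z‖ ≤ 1 / 5) :
    ‖V.padicFormalLog z - (z + (2 : ℚ_[5])⁻¹ * V.a₁ * z ^ 2 + (3 : ℚ_[5])⁻¹ * (V.a₁ ^ 2 + V.a₂) * z ^ 3)‖ ≤
      1 / 5 ^ 4 := by
  have hs := V.summable_formalLog_of_isIntegral z (hz.trans_lt (by norm_num))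
  have hsplit := hs.sum_add_tsum_nat_add 4
  have h0 : coeff 0 V.formalLog = 0 := by rw [coeff_zero_eq_constantCoeff]; exact V.constantCoeff_formalLog
  have h2 : coeff 2 V.formalLog = (2 : ℚ_[5])⁻¹ * V.a₁ := by
    rw [(coeff_two_formalLog V), eq_ratCast]; push_cast; ring
  have h3 : coeff 3 V.formalLog = (3 : ℚ_[5])⁻¹ * (V.a₁ ^ 2 + V.a₂) := by
    rw [(coeff_three_formalLog V), eq_ratCast]; push_cast; ring
  have hfour : ∑ i ∈ Finset.range 4, coeff i V.formalLog * z ^ i =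
      z + (2 : ℚ_[5])⁻¹ * V.a₁ * z ^ 2 + (3 : ℚ_[5])⁻¹ * (V.a₁ ^ 2 + V.a₂) * z ^ 3 := by
    simp only [Finset.sum_range_succ, Finset.sum_range_zero, h0, V.coeff_one_formalLog, h2, h3]
    ring
  rw [WeierstrassCurve.padicFormalLog, ← hsplit, hfour, add_sub_cancel_left]
  exact IsUltrametricDist.norm_tsum_le_of_forall_le_of_nonneg (by norm_num) fun n ↦
    (norm_formalLog_term_le_depthOne₄ V) hz n

end Padic

/-! ### §3 The integer model: `a₂`, and the uniformisation scale to FIRST digit, `C² ≡ −c₄/c₆ (mod 5)` -/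

section Model

variable (W : WeierstrassCurve ℚ) {a₁ a₂ a₃ a₄ a₆ : ℤ} (hW : W = ⟨a₁, a₂, a₃, a₄, a₆⟩)
include hW

/-- `a₂(W ⊗ ℚ₅) = a₂`. [folklore] -/
theorem baseChange_a₂_eq : (W.baseChange ℚ_[5]).a₂ = a₂ := by
  subst hW; rw [WeierstrassCurve.baseChange, WeierstrassCurve.map_a₂]; simp

/-- **The uniformisation scale to first digit**: for `‖q‖₅ < 1`, `5 ∤ c₄c₆` and an integer `Γ` with `5 ∣ c₄ + Γc₆`
(`Γ ≡ −c₄/c₆`), `‖uniformisationScaleSq W 5 q − Γ‖₅ ≤ 5⁻¹` (`C² = c₆(E_q)c₄/(c₄(E_q)c₆)` with `c₄(E_q) = 1 + 240s₃(q)`,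
`c₆(E_q) = −1 + 504s₅(q)`, `‖s_k(q)‖ ≤ ‖q‖ ≤ 5⁻¹`). [cite: SteinWuthrich2013, §4.2] [cite: SilvermanATAEC1994, Thm. V.3.1] -/
theorem norm_uniformisationScaleSq_sub_le_of_congr {c4 c6 Γ : ℤ}
    (hc4 : c4 = (a₁ ^ 2 + 4 * a₂) ^ 2 - 24 * (2 * a₄ + a₁ * a₃))
    (hc6 : c6 = -(a₁ ^ 2 + 4 * a₂) ^ 3 + 36 * (a₁ ^ 2 + 4 * a₂) * (2 * a₄ + a₁ * a₃) - 216 * (a₃ ^ 2 + 4 * a₆))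
    (h5c4 : ¬ (5 : ℤ) ∣ c4) (h5c6 : ¬ (5 : ℤ) ∣ c6) (hΓ : (5 : ℤ) ∣ c4 + Γ * c6) {q : ℚ_[5]} (hq : ‖q‖ < 1) :
    ‖uniformisationScaleSq W 5 q - Γ‖ ≤ 1 / 5 := by
  have hq1 : ‖q‖ ≤ 1 := hq.le
  have hq5 : ‖q‖ ≤ 1 / 5 := norm_le_fifth_of_norm_lt_one₂ hq
  have hs3 : ‖tateS 3 q‖ ≤ 1 / 5 := (TateCurve.norm_tateS_le hq1).trans hq5
  have hs5 : ‖tateS 5 q‖ ≤ 1 / 5 := (TateCurve.norm_tateS_le hq1).trans hq5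
  have h12 : (12 : ℚ_[5]) ≠ 0 := by norm_num
  rw [uniformisationScaleSq, TateCurve.tateCurve_c₄, TateCurve.tateCurve_c₆ h12, baseChange_c₄_eq W hW hc4,
    baseChange_c₆_eq W hW hc6, TateCurve.tateE4_eq, TateCurve.tateE6]
  set s3 := tateS 3 q
  set s5 := tateS 5 q
  have hint : ∀ n : ℤ, ‖(n : ℚ_[5])‖ ≤ 1 := fun n => Padic.norm_int_le_one n
  have h4 : ‖(c4 : ℚ_[5])‖ = 1 := norm_intCast_eq_one_of_not_dvd h5c4
  have h6 : ‖(c6 : ℚ_[5])‖ = 1 := norm_intCast_eq_one_of_not_dvd h5c6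
  have hc40 : (c4 : ℚ_[5]) ≠ 0 := by intro h; rw [h, norm_zero] at h4; exact zero_ne_one h4
  have hc60 : (c6 : ℚ_[5]) ≠ 0 := by intro h; rw [h, norm_zero] at h6; exact zero_ne_one h6
  -- `ε₄ = 240 s₃`, `ε₆ = 504 s₅` have norm `≤ 5⁻¹`
  have he4 : ‖(240 : ℚ_[5]) * s3‖ ≤ 1 / 5 := by
    rw [norm_mul, show (240 : ℚ_[5]) = ((240 : ℤ) : ℚ_[5]) by norm_cast]
    calc ‖((240 : ℤ) : ℚ_[5])‖ * ‖s3‖ ≤ 1 * (1 / 5) := by gcongr; exact hint 240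
      _ = 1 / 5 := one_mul _
  have he6 : ‖(504 : ℚ_[5]) * s5‖ ≤ 1 / 5 := by
    rw [norm_mul, show (504 : ℚ_[5]) = ((504 : ℤ) : ℚ_[5]) by norm_cast]
    calc ‖((504 : ℤ) : ℚ_[5])‖ * ‖s5‖ ≤ 1 * (1 / 5) := by gcongr; exact hint 504
      _ = 1 / 5 := one_mul _
  have hE4 : ‖1 + 240 * s3‖ = 1 := by
    have hsub : ‖(1 + 240 * s3) - 1‖ < ‖(1 : ℚ_[5])‖ := by
      rw [add_sub_cancel_left, norm_one]; exact he4.trans_lt (by norm_num)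
    rw [Padic.norm_eq_of_norm_sub_lt_right hsub, norm_one]
  have hB0 : (1 + 240 * s3) ≠ 0 := by intro h; rw [h, norm_zero] at hE4; exact zero_ne_one hE4
  -- the difference
  have hid : -(1 - 504 * s5) * (c4 : ℚ_[5]) / ((1 + 240 * s3) * (c6 : ℚ_[5])) - (Γ : ℚ_[5]) =
      (-((c4 : ℚ_[5]) + Γ * c6) + (504 * s5 * c4 - Γ * c6 * (240 * s3))) / ((1 + 240 * s3) * c6) := by
    field_simp; ring
  rw [hid, norm_div, norm_mul, hE4, h6, one_mul, div_one]
  refine (IsUltrametricDist.norm_add_le_max _ _).trans (max_le ?_ ?_)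
  · rw [norm_neg]
    have : ((c4 : ℚ_[5]) + Γ * c6) = ((c4 + Γ * c6 : ℤ) : ℚ_[5]) := by push_cast; ring
    rw [this]
    refine ((Padic.norm_int_le_pow_iff_dvd (p := 5) _ 1).mpr (by simpa using hΓ)).trans (by norm_num)
  · rw [sub_eq_add_neg]
    refine (IsUltrametricDist.norm_add_le_max _ _).trans (max_le ?_ ?_)
    · rw [norm_mul]
      calc ‖(504 : ℚ_[5]) * s5‖ * ‖(c4 : ℚ_[5])‖ ≤ 1 / 5 * 1 := by gcongr; exact h4.le
        _ = 1 / 5 := mul_one _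
    · rw [norm_neg, norm_mul, norm_mul]
      calc ‖(Γ : ℚ_[5])‖ * ‖(c6 : ℚ_[5])‖ * ‖(240 : ℚ_[5]) * s3‖ ≤ 1 * 1 * (1 / 5) := by
            gcongr
            · exact hint Γ
            · exact h6.le
        _ = 1 / 5 := by ring

end Model

end Summit.BirchSwinnertonDyer.Rank1Residual.X11b.RegMult.KernelCertFive
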